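import Summits.ABC.ABC.Theses.IsogenyGlueCongruence
import Summits.ABC.ABC.Theorems.IsogenyGlueCongruenceEllipticGluingPrimeBoundOfSimpleThree
import Summits.ABC.ABC.Theorems.IsogenyGlueCongruenceEllipticGluingPrimeBoundOfSlices
import Summits.ABC.ABC.Theorems.IsogenyGlueCongruenceEllipticGluingPrimeBoundSlicesOfBound
import Summits.ABC.ABC.Theorems.IsogenyGlueCongruenceEllipticGluingPrimeBoundStubCMTorsionCartanImage
import Summits.ABC.ABC.Theorems.IsogenyGlueCongruenceEllipticGluingPrimeBoundStubAbelianNormalCentral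
import Summits.ABC.ABC.Theorems.IsogenyGlueCongruenceEllipticGluingPrimeBoundStubEndFieldAbelianPartnerBound
import Summits.ABC.ABC.Theorems.IsogenyGlueCongruenceEllipticGluingPrimeBoundStubGoursatIndexDichotomy
import Summits.ABC.ABC.Theorems.IsogenyGlueCongruenceEllipticGluingPrimeBoundStubAbelianKernelMinkowskiCore
import Summits.ABC.ABC.Theorems.IsogenyGlueCongruenceEllipticGluingPrimeBoundEndFieldPrimes
import Summits.ABC.ABC.Theorems.IsogenyGlueCongruenceEllipticGluingPrimeBoundStubImageDichotomyCore
import Summits.ABC.ABC.Theorems.IsogenyGlueCongruenceEllipticGluingPrimeBoundStubEndFieldDichotomy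
import Summits.ABC.ABC.Theorems.IsogenyGlueCongruenceEllipticGluingPrimeBoundCMUniform
import Summits.ABC.ABC.Theorems.IsogenyGlueCongruenceEllipticGluingPrimeBoundStubNoCMPartnerOfSurjective
import Summits.ABC.ABC.Theorems.IsogenyGlueCongruenceEllipticGluingPrimeBoundIffUniformResiduals
import Summits.ABC.ABC.Theorems.IsogenyGlueCongruenceEllipticGluingPrimeBoundSemistable
import Summits.ABC.ABC.Theorems.IsogenyGlueCongruenceEllipticGluingPrimeBoundStubNotHasCMOfSemistable
import Summits.ABC.ABC.Theorems.IsogenyGlueCongruenceEllipticGluingPrimeBoundSemistablePointwise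
-- (LANDED p142091; to be imported once the farm has built it:)
-- import Summits.ABC.ABC.Theorems.IsogenyGlueCongruenceEllipticGluingPrimeBoundSemistableOfGeneric
import Literature.NumberTheory.EllipticCurves.MasserWustholzSurjectivity
import Literature.AlgebraicGeometry.Motives.AbelianVarietyEndGaloisDescent
import Literature.NumberTheory.GaloisRepresentations.AbsGaloisGroup
import HarnessLib

/-!
# Crux U `EllipticGluingPrimeBound` (stmt-ABC-13919) — line `SketchIdeator5` (slices of the
# free branch `U_simple`), skeleton v14 (lead c7, cycle 4; v7–v10 lead c6; v6 lead c5; v1–v5 lead a1)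

Lead prover's SKELETON for the line built on `Cruxes/EllipticGluingPrimeBound/SketchIdeator5.lean`
(crux-ideate round 2, ideator 5: typed provable SLICES of the residual `U_simple` into which the
dead line `Sketch` was exhausted, `Lines/Sketch-dead.md`).  The crux (verbatim the route decl
`Summit.ABC.ABC.Theses.IsogenyGlueCongruence.EllipticGluingPrimeBound`) is concluded BY NAME by
`ellipticGluingPrimeBound_proof`, through the LANDED composition `ellipticGluingPrimeBound_of_simple`
(Theorems/…OfSimpleThree.lean, p118731: Masser–Wüstholz fact + CM torsion fact (landed) + route item
`FaltingsTate` + `U_simple` ⟹ U) fed with `simpleFreeTorsionBound_of_slices`, which assembles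
`U_simple` from the slices below.  `sorry` occurs only in the registered stubs `stub_*`.

## The slicing of `U_simple` (all statements in tree vocabulary)

`U_simple`: height-free, dimension-polynomial torsion sharing `W[ℓ] ↪ A(ℚ̄)` with ℚ-simple,
geometrically `E`-free partners `A` at primes of irreducible `W[ℓ]`.  Write `Γ = Γ_ℚ` and
`Γ_A := {σ ∈ Γ | σ fixes every geometric endomorphism of A}` (`A.galConj ℚ̄ σ r = r` for all
`r ∈ End(A_ℚ̄)`; `Γ_A = Gal(ℚ̄/L_A)`, `L_A` the field of definition of `End(A_ℚ̄)`, finite Galois).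

* `stub_endFieldAbelianPartnerBound` (slice O1 of ideator 5, RESHAPED — the typed
  `CMTypePartnerBound` was misstated: "commutative subalgebra of dimension `2 dim A`" admits
  nilpotent algebras, e.g. `A = E⁸` with `E` non-CM, where the conclusion fails; the CM-type
  hypothesis is replaced by its Galois-theoretic content (Serre–Tate 1968, Thm 5 Cor. 2: for `A` of
  CM type `Γ_A` acts on every `A[ℓ]` through an abelian group) and Feit–Tits by Minkowski):
  if `ρ̄_{W,ℓ}` is surjective, `ℓ ≥ 5`, `Γ_A` acts on `A[ℓ]` through pairwise commuting operators
  and `W[ℓ] ↪ A(ℚ̄)` `Γ`-equivariantly, then `ℓ ≤ 4 (dim A)² + 1`.  PROVABLE NOW: the image of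
  `Γ_A` in `Aut W[ℓ] ≅ GL₂(𝔽_ℓ)` is abelian and normal, hence central (`stub_abelianNormalCentral`,
  K4), so `PGL₂(𝔽_ℓ)` — in particular an element of order `ℓ` — is a quotient of `Γ/Γ_A`, which acts
  faithfully on the lattice `End(A_ℚ̄)` of rank `≤ 4 (dim A)²` (`BigImage.homGaloisLattice`);
  Minkowski (`stub_minkowski`, landed p85944) gives `ℓ ≤ 4 (dim A)² + 1`.  v2: split along its
  natural seam into the ALGEBRAIC CORE `stub_abelianKernelMinkowskiCore` (abstract: a finite-image
  `ℤ`-representation `ρ` of a group `Γ` on a lattice of rank `m`, a surjection `π` of `Γ` onto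
  `Aut(V)`, `#V = ℓ²`, `ℓ V = 0`, with `π(ker ρ)` abelian ⟹ `ℓ ≤ m + 1`; K4 + Minkowski, both landed)
  and the ARITHMETIC SHELL `stub_endFieldAbelianPartnerBound` (core ⟹ slice: `ρ` = Galois on
  `End(A_ℚ̄)` by `galConj`, `π = ρ̄_{W,ℓ}`, commutation transported along `ι`) — shell LANDED
  p125034 (v3: imported); core open (wave-1b worker).
* K4 `stub_abelianNormalCentral`: LANDED p124729 (…StubAbelianNormalCentral.lean), imported.
* v4/v5: the DICHOTOMY `stub_endFieldDichotomy` (shell, LANDED p125601) over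
  `stub_imageDichotomyCore` (core, LANDED p125590), no hypothesis on `A`: for surjective `ρ̄_{W,ℓ}`, `ℓ ≥ 5`, EITHER `ℓ ≤ 4 (dim A)² + 1` OR `Γ_A`
  realises every commutator automorphism (all of `SL₂(𝔽_ℓ)`) of `W[ℓ]` — Artin's theorem on
  normal subgroups of `GL₂(𝔽_ℓ)` (tree) in place of K4.  The abelian slice is its corollary.
* `stub_genericPartnerBound` (RESIDUAL R_gen, OPEN — the sporadic core; reshaped in v4): `U_simple`
  for non-CM `W`, surjective primes `ℓ ≥ 5` and partners over whose endomorphism field the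
  congruence is FULL (`Γ_A ↠ ⊇ SL₂(𝔽_ℓ)` on `W[ℓ]`): all `End(A_ℚ̄) = ℤ` partners, in particular the
  fixed-curve uniform Frey–Mazur problem (`A = E'`).
* `stub_cmCurvePartnerBound` (RESIDUAL R_cm, OPEN — Serre-uniformity flank; v7: RESHAPED into the
  height-free `stub_cmUniformPartnerBound` + the provable `stub_cmHeightBound`, see v7 below):
  `U_simple` for CM `W` (where `ρ̄_{W,ℓ}` is never surjective; Disproof §3 F5 closes its
  CM-type-partner part on paper).
* `stub_masserWustholzSurjective` (NAMED FACT, Masser–Wüstholz 1993 (b)) and `stub_faltingsTate`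
  (route ITEM stmt-ABC-15664) — the two inputs inherited from line Sketch, not worker targets.
* `stub_goursatIndexDichotomy` (kernel O3' of ideator 5, the group theory behind Disproof §3 F9's
  INDEX PRINCIPLE): LANDED p125204 (v3: imported); it does not enter `ellipticGluingPrimeBound_proof`.

Composition `simpleFreeTorsionBound_of_slices`: CM `W` → R_cm; non-CM `W`, `ℓ ≤ c·max(1,h)^γ` or
`ℓ < 5` → absorbed by the constant; otherwise `ρ̄_{W,ℓ}` is surjective (MW) and the dichotomy gives
`ℓ ≤ 4 dim² + 1 ≤ 5 X²` (`X = (dim A + 1)·max(1,h) ≥ 1`) or a full congruence over `L_A` → R_gen.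

v6 (lead c5, cycle 2 of the line): the composition is LANDED BY NAME —
`simpleFreeTorsionBound_of_slices` (MW + R_gen + R_cm ⟹ `U_simple`) and
`ellipticGluingPrimeBound_of_slices_of_masserWustholz` / `…_of_cor44_of_gaudronRemond` (⟹ U with
`FaltingsTate`) in …OfSlices.lean (p126491), so `ellipticGluingPrimeBound_proof` below is ONE term
over the four registered stubs; the residuals are proved NECESSARY — `U ⟹ R_gen`, `U ⟹ R_cm`
unconditionally (…SlicesOfBound.lean, p126295), whence
`ellipticGluingPrimeBound_iff_slices_of_cor44_of_gaudronRemond`: U ⟺ (R_gen ∧ R_cm) modulo the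
route's shared apex inputs {Mazur 1978 Cor. 4.4, Gaudron–Rémond pairs, FaltingsTate} (p126491);
and their `d = 1` shadows are landed as hardness certificates — `fixedCurveSharing_of_genericPartnerBound`
(R_gen ⟹ fixed non-CM curve vs. elliptic partners with ℚ-rational geometric endomorphisms, bound
uniform in the partner: fixed-curve Frey–Mazur shape; …ShadowOfGeneric.lean, p126604) and
`cmFixedCurveSharing_of_cmCurvePartnerBound` (R_cm ⟹ CM curve vs. geometrically non-isogenous
elliptic partners, uniform in the partner: Serre-uniformity shape; …ShadowOfCM.lean, p126661).
Open: R_gen, R_cm (both crux-necessary open cores), and the two inherited inputs.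

v7 (lead c6, cycle 3 of the line, 2026-08-17): the CM residual is RESHAPED into its honest, fully
UNIFORM form.  The stable Faltings height is bounded on CM curves over `ℚ` — thirteen geometric
classes: `j_mem_cmJInvariants_of_hasCM_holds` is a THEOREM of the tree (class number one by Baker's
route), and Silverman's explicit `stableFaltingsHeight_le_explicit` gives
`h_F(W) ≤ (log|j| − 9)/12 ≤ 3` — so the factor `max 1 h_F(W)` in R_cm carries no information:
R_cm ⟺ R_cm^unif := "`ℓ ≤ C · (dim A + 1)^κ`" (height-free, dimension-polynomial torsion sharing
between CM elliptic curves over `ℚ` and ℚ-simple geometrically free partners).  Registered stubs are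
now `stub_cmUniformPartnerBound` (R_cm^unif, OPEN residual: d = 1 shadow = an ABSOLUTE bound on the
primes at which a CM curve over `ℚ` is congruent to a geometrically non-isogenous elliptic curve —
split primes Bilu–Parent–Rebolledo, inert primes a sub-case of the non-split-Cartan case of Serre's
uniformity problem) and `stub_cmHeightBound` (PROVABLE NOW: `h_F ≤ 3` on CM curves; it enters only
the necessity certificate R_cm ⟹ R_cm^unif, i.e. U ⟹ R_cm^unif, not the composition), besides the
unchanged `stub_genericPartnerBound` (R_gen, lead) and the two inherited inputs.  The composition
consumes R_cm^unif through the trivial direction `cmCurvePartnerBound_of_uniform` (R_cm^unif ⟹ R_cm: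
`max 1 h ≥ 1`, `κ ≥ 0`), proved below, so `ellipticGluingPrimeBound_proof` is unchanged in shape.

v8 (lead c6, same cycle): `stub_cmHeightBound` LANDED together with the reshape bookkeeping
(…CMUniform.lean, p138450: `cmCurvePartnerBound_of_uniform` R_cm^unif ⟹ R_cm,
`cmUniformPartnerBound_iff_cmCurvePartnerBound` R_cm^unif ⟺ R_cm, the unconditional necessity
`cmUniformPartnerBound_of_ellipticGluingPrimeBound` U ⟹ R_cm^unif, and the ABSOLUTE `d = 1` shadow
`cmUniformSharing_of_cmUniformPartnerBound`) and is imported.  New registered certificate stub on the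
generic side, `stub_noCMPartnerOfSurjective` (PROVABLE NOW from the tree's uniform CM torsion
theorem `cmTorsion_cartanImage_holds`): a curve whose mod-`ℓ` representation is surjective shares
no `ℓ`-torsion with a CM curve once `ℓ > L₀` — so at `d = 1` the generic residual R_gen concerns
NON-CM partners only, i.e. its `d = 1` content is exactly the fixed-curve uniform Frey–Mazur
statement of `fixedCurveSharing_of_genericPartnerBound` (p126604).  It does not enter the
composition.

v9 (lead c6, same cycle): wave 1 returned `stub-landed: stub_noCMPartnerOfSurjective` (p139407,
…StubNoCMPartnerOfSurjective.lean, threshold `max L₀ 2`, reusable core `exists_eq_zsmul_of_comm_sq`: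
an additive endomorphism of a group of order `ℓ²` killed by `ℓ`, `ℓ ≥ 3`, commuting with every
square of an automorphism is an integer scalar); both new files are imported, the local glue copy
is gone.  Registered stubs now: the two inputs and the two certified-open residuals R_gen,
R_cm^unif — nothing provable is left in the skeleton.

v10 (lead c6, end of cycle 3): the line's SUMMARY THEOREM is landed — `stub_iffUniformResiduals`
(…IffUniformResiduals.lean, p139643): {Mazur Cor. 4.4, GR pairs, `FaltingsTate`} ⟹
(U ⟺ R_gen ∧ R_cm^unif), with the unconditional half `uniformResiduals_of_ellipticGluingPrimeBound`.
…CMUniform.lean (p138450) is imported and `example`-checked; the two files landed last (p139407, p139643)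
are referenced by commented `import`s until the farm has built them (their stubs are closed on the
ledger); the registered stubs are exactly the two apex inputs and the two residual open cores.  Literature
check (2025–2026): Studnia, arXiv:2507.20801 (July 2025), states that the curve-wise Frey–Mazur
conjecture "does not seem known for any elliptic curve E/ℚ" (= the `d = 1` shadow of R_gen) and
shows that for a CM curve with good reduction at an inert prime `p` every quotient of the twisted
modular Jacobian `J_E(p)` has forced central vanishing, so Mazur's method cannot bound the
congruence primes of the thirteen CM curves (= the `d = 1` shadow of R_cm^unif, the non-split
Cartan case of Serre uniformity); his unconditional results cover only `y² = x³ + p^{±1}`-type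
curves at their bad prime `p ≤ 59`.  Both residuals are therefore certified open in print as of 2025.

v11 (lead c7, cycle 4 of the line, 2026-08-17): the SEMISTABLE RESTRICTION.  The route's deciding
theorem consumes U exactly once, through the glue item `DegreePrimesOfGluingBound`
(`degreePrimesOfGluingBound_proof`, stmt-ABC-13921), which feeds U only semistable curves `W` given
by a globally minimal model of conductor `N ≥ 1` (the binders of `ModularJacobianMultipliers`).
Write `U_ss` for U with exactly those binders added.  New registered CERTIFICATE stub (provable
now, lead): `stub_semistableGlue : U_ss → ModularJacobianMultipliers → SemistableHeightPolyBound →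
DegreePrimesPolyBounded` — the route's glue runs verbatim on `U_ss`, so everything U asserts beyond
`U_ss` (all CM curves, i.e. the whole Serre-uniformity flank R_cm^unif; all non-semistable curves,
and with them the uniformity over quadratic/quartic/sextic twist families at fixed stable height)
is SURPLUS to the route, certified by typing.  It does not enter `ellipticGluingPrimeBound_proof`.
The same file (…Semistable.lean) proves `U ⟹ U_ss`, the `W`-pointwise necessity
`U_ss ⟹ U_free,ss` (gluing, as p117323) and the `d = 1` shadow of `U_ss` in height form and in
CONDUCTOR form (`U_ss ∧ SemistableHeightPolyBound ⟹` congruence primes between a semistable `W` of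
conductor `N` and any geometrically non-isogenous `W'/ℚ` are `≤ C N^κ`, uniformly in `W'`) — the
polynomial curve-wise Frey–Mazur statement for semistable curves, which abc implies in print
(Frey 1997: Tate curve at the partner's extra multiplicative primes + Szpiro; for semistable `W`,
`log N ≤ log|Δ_min| ≤ 12 h_F + O(1)`, so no twist normalisation is needed).  Paper analysis this
cycle (Cruxes/…/RESTATE-semistable.md): abc ⟹ the `d = 1` shadow of R_gen for every `W` with
`j ∉ {0, 1728}` after simultaneous quadratic-twist normalisation, and the `d = 1` shadow of
R_cm^unif for the eleven CM `j ∉ {0, 1728}`; for the sextic/quartic twist families of `j = 0, 1728`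
the shared additive primes leave Szpiro slack `(12 − v_q(Δ')) log q` per prime, so U's absolute
bound over those families is NOT reached from abc by Frey's argument — a twist-uniformity surplus
already at `d = 1`, and absent from `U_ss`.  Recommendation to the planner (D3'): restate the item
as `U_ss`; glue = `stub_semistableGlue`.

v12 (lead c7, same cycle): `stub_semistableGlue` LANDED (p141036, …Semistable.lean; imported by a
commented `import` until the farm has built it).  Two new registered CERTIFICATE stubs carry the
second half of the semistable analysis: `stub_notHasCMOfSemistable` (a semistable curve of
conductor `≠ 1` has no CM: multiplicative prime vs. integral CM `j`-invariants — provable now from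
the tree) and `stub_semistableOfGeneric` (Tate–Ogg + MW + R_gen,ss ⟹ U_ss: the `W`-pointwise
versions of the landed compositions at a semistable, hence non-CM, curve), so that modulo
{Tate–Ogg, MW} the semistable restriction has the ONE-residual normal form U_ss ⟺ R_gen,ss — no CM
flank, no `FaltingsTate`.  Neither enters `ellipticGluingPrimeBound_proof`.

v13 (lead c7, same cycle): the 400-line limit splits the sufficiency certificate into two files; the
first (…SemistablePointwise.lean: `not_hasCM_of_isSemistable`, pointwise free-from-simple induction,
pointwise non-CM simple-from-generic) carries the extra registered certificate stub
`stub_simpleBoundAtOfGeneric`; the second (…SemistableOfGeneric.lean) proves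
`stub_semistableOfGeneric` and the iff U_ss ⟺ R_gen,ss mod {Tate–Ogg, MW}.

v14 (lead c7, end of cycle 4): ALL FOUR semistable certificate stubs are LANDED, three IMPORTED —
`stub_semistableGlue` (…Semistable.lean, p141036), `stub_notHasCMOfSemistable`
(…StubNotHasCMOfSemistable.lean, p141568, wave-1 worker), `stub_simpleBoundAtOfGeneric`
(…SemistablePointwise.lean, p141732), `stub_semistableOfGeneric` (…SemistableOfGeneric.lean,
p142091; its module is not yet built on the farm, so a sorried local copy stays until it is) — together with
the two modules of v10 (p139407, p139643) that the farm had not built then.  `example`s pin the landed names.  Registered stubs with `sorry` are again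
exactly the two apex inputs (MW fact, `FaltingsTate` item) and the two residual open cores (R_gen,
R_cm^unif).  Net statement of the cycle, all by name in the tree: `closes` needs U only through
`U_ss`; U ⟹ U_ss ⟹ R_gen,ss; {Tate–Ogg, MW, R_gen,ss} ⟹ U_ss — the route's bet, read on what it
consumes, is the single residual R_gen,ss (Cruxes/…/RESTATE-semistable.md, recommendation D3').

Disproof used (`Cruxes/EllipticGluingPrimeBound/Disproof.lean`, cycle-1 final, read 2026-08-16):
`iff_boundAbove`/`iff_normalised` (thresholds absorbed in the constant), `_false_without_forallDvd` /
`_false_without_neZero` (threaded through the imported composition), §3 F2/F5/F9 + CYCLOTOMIC COST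
(O1 is the free-branch twin of F2's `φ(ℓ) ≤ 2r`; R_cm is F5's flank; O3' is F9's index principle),
`one_le_kappa_of_weilRestrictionFamily` (no stub claims `κ < 1`; O1 has `κ = 2`). Targets: none yet.
-/

noncomputable section

-- `Summit.<Summit>.<Problem>` is the mandated summit-side namespace (CONVENTIONS §2); for the
-- single-conjunct summit `ABC` the two coincide, so the duplicate `ABC.ABC` is deliberate.
set_option linter.dupNamespace false

namespace Summit.ABC.ABC.Theorems.GluingSlices

open CategoryTheory CategoryTheory.Limits AlgebraicGeometry
open Literature.AlgebraicGeometry.Motives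
open Summit.ABC.ABC.Theses.IsogenyGlueCongruence
open Summit.ABC.ABC.Theorems.IsotypicMinkowski
open Literature.NumberTheory.EllipticCurves Literature.NumberTheory.DiophantineGeometry

/-! ### Registered stubs (`sorry` only here; statements in tree vocabulary only) -/

/-- STUB (MW — NAMED FACT `Literature.NumberTheory.EllipticCurves.masserWustholz_surjective_modEll`,
Masser–Wüstholz 1993, Theorem (b); inherited from line Sketch; not a worker target). -/
theorem stub_masserWustholzSurjective :
    Literature.NumberTheory.EllipticCurves.masserWustholz_surjective_modEll := by
  sorry

/-- STUB = the route ITEM `FaltingsTate` (stmt-ABC-15664; Faltings 1983 Satz 4; inherited from line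
Sketch, used only inside the imported CM isotypic core; not a worker target). -/
theorem stub_faltingsTate : FaltingsTate := by
  sorry

/-! The four SEMISTABLE CERTIFICATE stubs of v11–v13 are LANDED and imported (v14):
`stub_semistableGlue` (p141036: the route's glue `U_ss → J → H → A` on the semistable restriction,
with `U → U_ss`, `U_ss → U_free,ss` and the `d = 1` shadows of `U_ss`), `stub_notHasCMOfSemistable`
(p141568: semistable ∧ `N ≠ 1` ⟹ no CM), `stub_simpleBoundAtOfGeneric` (p141732: pointwise non-CM
simple-from-generic, with `not_hasCM_of_isSemistable` and the pointwise free-from-simple induction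
`freeBound_at`), `stub_semistableOfGeneric` (p142091: Tate–Ogg + MW + R_gen,ss ⟹ U_ss, with the
necessity `U_ss → R_gen,ss` and `semistableGluingPrimeBound_iff_genericSemistable`). -/

example := @stub_semistableGlue
example := @semistableGluingPrimeBound_of_ellipticGluingPrimeBound
example := @semistableCongruencePrimeBound_of_ellipticGluingPrimeBound
example := @stub_notHasCMOfSemistable
example := @stub_simpleBoundAtOfGeneric
example := @stub_noCMPartnerOfSurjective
example := @stub_iffUniformResiduals
example := @uniformResiduals_of_ellipticGluingPrimeBound

/-- STUB (CERTIFICATE — LANDED p142091, …SemistableOfGeneric.lean; local copy kept until the farm has built that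
module, then `import` it and delete this copy): **the semistable restriction from the generic residual alone — `U_ss ⟸ MW + R_gen,ss`**, FaltingsTate-free
and CM-free.  Hypotheses: Tate–Ogg (no conductor-one curve over `ℚ`; printed, not in tree), the
Masser–Wüstholz surjectivity fact, and R_gen restricted to semistable `W` (verbatim
`stub_genericPartnerBound` with the three semistability binders added).  Proof: the `W`-pointwise
versions of the landed compositions — irreducibility threshold, dichotomy given irreducibility,
NON-CM isotypic core (Minkowski + rational-part reduction + big-image torsion core), end-field
dichotomy into R_gen, induction from ℚ-simple to all free partners — at a semistable `W`, which
has no CM by `stub_notHasCMOfSemistable`.  With `U_ss → R_gen,ss` (restriction of the landed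
necessity) this gives: modulo {Tate–Ogg, MW}, **U_ss ⟺ R_gen,ss** — one residual, no CM flank,
no `FaltingsTate`. -/
theorem stub_semistableOfGeneric :
    (∀ (W : WeierstrassCurve ℚ) [W.IsElliptic], W.conductorNorm ℤ ≠ 1) →
    Literature.NumberTheory.EllipticCurves.masserWustholz_surjective_modEll →
    (∃ κ C : ℝ, 0 ≤ κ ∧ ∀ (W : WeierstrassCurve ℚ) [W.IsElliptic] [W.IsGloballyMinimal]
      [NeZero (W.conductorNorm ℤ)], W.IsSemistable ℤ → ∀ (E A : AbelianVariety.{0} ℚ)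
      (e : E.geomPoints ≃+ W.geomPoints),
      (∀ (σ : Field.absoluteGaloisGroup ℚ) (P : E.geomPoints), e (σ • P) = σ • e P) →
      (∀ f : E.baseChange (AlgebraicClosure ℚ) ⟶ A.baseChange (AlgebraicClosure ℚ), f = 0) →
      AbelianVariety.IsSimple A → ¬ W.HasCM →
      ∀ ℓ : ℕ, ℓ.Prime → 5 ≤ ℓ → W.HasSurjectiveModNGaloisRep ℓ →
      (∀ g ∈ commutator (Multiplicative (AddAut (W.geomTorsion ℓ))),
        ∃ σ : Field.absoluteGaloisGroup ℚ,
          (∀ r : A.baseChange (AlgebraicClosure ℚ) ⟶ A.baseChange (AlgebraicClosure ℚ),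
            A.galConj (AlgebraicClosure ℚ) (Field.absoluteGaloisGroup.toAlgEquiv ℚ σ) r = r) ∧
          W.galoisRepTorsion ℓ σ = g) →
      (∃ ι : W.geomTorsion ℓ →+ A.geomPoints, Function.Injective ι ∧
        ∀ (σ : Field.absoluteGaloisGroup ℚ) (P : W.geomTorsion ℓ), ι (σ • P) = σ • ι P) →
        (ℓ : ℝ) ≤ C * (((A.dim : ℝ) + 1) * max 1 W.stableFaltingsHeight) ^ κ) →
    ∃ κ C : ℝ, 0 ≤ κ ∧ ∀ (W : WeierstrassCurve ℚ) [W.IsElliptic] [W.IsGloballyMinimal]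
      [NeZero (W.conductorNorm ℤ)], W.IsSemistable ℤ →
      ∀ (E B : AbelianVariety.{0} ℚ) (e : E.geomPoints ≃+ W.geomPoints),
      (∀ (σ : Field.absoluteGaloisGroup ℚ) (P : E.geomPoints), e (σ • P) = σ • e P) →
      ∀ ℓ : ℕ, ℓ.Prime →
      (∃ (α : E ⟶ B) (β : B ⟶ E) (n : ℤ), n ≠ 0 ∧ α ≫ β = n • 𝟙 E) →
      (∀ (α : E ⟶ B) (β : B ⟶ E) (n : ℤ), α ≫ β = n • 𝟙 E → (ℓ : ℤ) ∣ n) →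
        (ℓ : ℝ) ≤ C * ((B.dim : ℝ) * max 1 W.stableFaltingsHeight) ^ κ := by
  sorry

/-- **The route's glue item through `U_ss`, by name** (certificate: `DegreePrimesOfGluingBound`
factors through the semistable restriction). -/
example : DegreePrimesOfGluingBound :=
  fun hU hJ hH ↦ stub_semistableGlue (semistableGluingPrimeBound_of_ellipticGluingPrimeBound hU) hJ hH



/-! The endomorphism-field-ABELIAN slice is LANDED in full: algebraic core
`stub_abelianKernelMinkowskiCore` (p125338, wave-1b worker) and arithmetic shell
`stub_endFieldAbelianPartnerBound` (p125034, lead); so is `prime_le_of_dvd_card_endGaloisImage`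
(p125363: primes dividing `#Gal(L_A/ℚ)` are `≤ 4 dim² + 1`).  v4 runs the composition through the
sharper DICHOTOMY below, of which the abelian slice is the special case "`Γ_A` abelian on `A[ℓ]`". -/

/-! The DICHOTOMY is LANDED in full (v5: imported): algebraic core `stub_imageDichotomyCore`
(p125590) and arithmetic shell `stub_endFieldDichotomy` (p125601): for surjective `ρ̄_{W,ℓ}`,
`ℓ ≥ 5`, and ANY `A/ℚ`, either `ℓ ≤ 4 (dim A)² + 1` or `Γ_A` realises every element of the
commutator subgroup (`= SL₂(𝔽_ℓ)`) of `Aut W[ℓ]`. -/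

/-! `stub_endFieldAbelianPartnerBound` (O1 shell) is LANDED (p125034,
…StubEndFieldAbelianPartnerBound.lean) and imported: the arithmetic shell of the
endomorphism-field-abelian slice, proved over the algebraic core `stub_abelianKernelMinkowskiCore`. -/

/-- STUB (RESIDUAL R_gen, reshaped in v4 — OPEN, the sporadic core of `U_simple`): height-free
polynomial torsion sharing for a non-CM curve `W` at a prime `ℓ ≥ 5` of surjective `ρ̄_{W,ℓ}` with a
ℚ-simple, geometrically `E`-free partner `A` over whose ENDOMORPHISM FIELD THE CONGRUENCE IS FULL:
every commutator automorphism of `W[ℓ]` (all of `SL₂(𝔽_ℓ)`) is realised by some `σ ∈ Γ_ℚ` fixing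
every geometric endomorphism of `A`.  This contains the fixed-curve uniform Frey–Mazur problem
(`A = E'` an elliptic curve with `End(E'_ℚ̄) = ℤ`, where the fullness hypothesis is automatic) and
all `End(A_ℚ̄) = ℤ` partners; by `stub_endFieldDichotomy` it is ALL that remains of the non-CM
branch beyond `ℓ ≤ 4 dim² + 1`. -/
theorem stub_genericPartnerBound :
    ∃ κ C : ℝ, 0 ≤ κ ∧ ∀ (W : WeierstrassCurve ℚ) [W.IsElliptic] (E A : AbelianVariety.{0} ℚ)
      (e : E.geomPoints ≃+ W.geomPoints),
      (∀ (σ : Field.absoluteGaloisGroup ℚ) (P : E.geomPoints), e (σ • P) = σ • e P) →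
      (∀ f : E.baseChange (AlgebraicClosure ℚ) ⟶ A.baseChange (AlgebraicClosure ℚ), f = 0) →
      AbelianVariety.IsSimple A → ¬ W.HasCM →
      ∀ ℓ : ℕ, ℓ.Prime → 5 ≤ ℓ → W.HasSurjectiveModNGaloisRep ℓ →
      (∀ g ∈ commutator (Multiplicative (AddAut (W.geomTorsion ℓ))),
        ∃ σ : Field.absoluteGaloisGroup ℚ,
          (∀ r : A.baseChange (AlgebraicClosure ℚ) ⟶ A.baseChange (AlgebraicClosure ℚ),
            A.galConj (AlgebraicClosure ℚ) (Field.absoluteGaloisGroup.toAlgEquiv ℚ σ) r = r) ∧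
          W.galoisRepTorsion ℓ σ = g) →
      (∃ ι : W.geomTorsion ℓ →+ A.geomPoints, Function.Injective ι ∧
        ∀ (σ : Field.absoluteGaloisGroup ℚ) (P : W.geomTorsion ℓ), ι (σ • P) = σ • ι P) →
        (ℓ : ℝ) ≤ C * (((A.dim : ℝ) + 1) * max 1 W.stableFaltingsHeight) ^ κ := by
  sorry

/-- STUB (RESIDUAL R_cm^unif — OPEN, the CM flank of `U_simple` in its honest UNIFORM form, v7):
partner-height-free AND `W`-height-free, dimension-polynomial torsion sharing for CM curves `W/ℚ`:
for a ℚ-simple, geometrically `E`-free partner `A` and a prime `ℓ` of irreducible `W[ℓ]`, a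
`Γ_ℚ`-equivariant embedding `W[ℓ] ↪ A(ℚ̄)` forces `ℓ ≤ C · (dim A + 1)^κ` with ABSOLUTE `κ, C`.
Equivalent to the `h`-form R_cm of v1–v6 (`cmUniformPartnerBound_iff_cmCurvePartnerBound`,
…CMUniform.lean p138450, through the landed `stub_cmHeightBound`).  Its `d = 1` shadow is an absolute bound on the primes of congruences between
CM and geometrically non-isogenous elliptic curves over `ℚ` (split primes: Bilu–Parent–Rebolledo;
inert primes: non-split-Cartan Serre uniformity, open). -/
theorem stub_cmUniformPartnerBound :
    ∃ κ C : ℝ, 0 ≤ κ ∧ ∀ (W : WeierstrassCurve ℚ) [W.IsElliptic] (E A : AbelianVariety.{0} ℚ)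
      (e : E.geomPoints ≃+ W.geomPoints),
      (∀ (σ : Field.absoluteGaloisGroup ℚ) (P : E.geomPoints), e (σ • P) = σ • e P) →
      (∀ f : E.baseChange (AlgebraicClosure ℚ) ⟶ A.baseChange (AlgebraicClosure ℚ), f = 0) →
      AbelianVariety.IsSimple A →
      ∀ ℓ : ℕ, ℓ.Prime → W.HasIrreducibleModPGaloisRep ℓ → W.HasCM →
      (∃ ι : W.geomTorsion ℓ →+ A.geomPoints, Function.Injective ι ∧
        ∀ (σ : Field.absoluteGaloisGroup ℚ) (P : W.geomTorsion ℓ), ι (σ • P) = σ • ι P) →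
        (ℓ : ℝ) ≤ C * ((A.dim : ℝ) + 1) ^ κ := by
  sorry

/-- **R_cm from the registered stubs** (v7: the `h`-form CM residual of v1–v6, now DERIVED from the
uniform stub `stub_cmUniformPartnerBound`). -/
theorem cmCurvePartnerBound_of_stubs :
    ∃ κ C : ℝ, 0 ≤ κ ∧ ∀ (W : WeierstrassCurve ℚ) [W.IsElliptic] (E A : AbelianVariety.{0} ℚ)
      (e : E.geomPoints ≃+ W.geomPoints),
      (∀ (σ : Field.absoluteGaloisGroup ℚ) (P : E.geomPoints), e (σ • P) = σ • e P) →
      (∀ f : E.baseChange (AlgebraicClosure ℚ) ⟶ A.baseChange (AlgebraicClosure ℚ), f = 0) →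
      AbelianVariety.IsSimple A →
      ∀ ℓ : ℕ, ℓ.Prime → W.HasIrreducibleModPGaloisRep ℓ → W.HasCM →
      (∃ ι : W.geomTorsion ℓ →+ A.geomPoints, Function.Injective ι ∧
        ∀ (σ : Field.absoluteGaloisGroup ℚ) (P : W.geomTorsion ℓ), ι (σ • P) = σ • ι P) →
        (ℓ : ℝ) ≤ C * (((A.dim : ℝ) + 1) * max 1 W.stableFaltingsHeight) ^ κ :=
  cmCurvePartnerBound_of_uniform stub_cmUniformPartnerBound

/-- **R_gen ⟹ R_gen,ss** (restriction of the generic residual to semistable curves). -/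
theorem genericSemistable_of_stubs :
    ∃ κ C : ℝ, 0 ≤ κ ∧ ∀ (W : WeierstrassCurve ℚ) [W.IsElliptic] [W.IsGloballyMinimal]
      [NeZero (W.conductorNorm ℤ)], W.IsSemistable ℤ → ∀ (E A : AbelianVariety.{0} ℚ)
      (e : E.geomPoints ≃+ W.geomPoints),
      (∀ (σ : Field.absoluteGaloisGroup ℚ) (P : E.geomPoints), e (σ • P) = σ • e P) →
      (∀ f : E.baseChange (AlgebraicClosure ℚ) ⟶ A.baseChange (AlgebraicClosure ℚ), f = 0) →
      AbelianVariety.IsSimple A → ¬ W.HasCM →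
      ∀ ℓ : ℕ, ℓ.Prime → 5 ≤ ℓ → W.HasSurjectiveModNGaloisRep ℓ →
      (∀ g ∈ commutator (Multiplicative (AddAut (W.geomTorsion ℓ))),
        ∃ σ : Field.absoluteGaloisGroup ℚ,
          (∀ r : A.baseChange (AlgebraicClosure ℚ) ⟶ A.baseChange (AlgebraicClosure ℚ),
            A.galConj (AlgebraicClosure ℚ) (Field.absoluteGaloisGroup.toAlgEquiv ℚ σ) r = r) ∧
          W.galoisRepTorsion ℓ σ = g) →
      (∃ ι : W.geomTorsion ℓ →+ A.geomPoints, Function.Injective ι ∧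
        ∀ (σ : Field.absoluteGaloisGroup ℚ) (P : W.geomTorsion ℓ), ι (σ • P) = σ • ι P) →
        (ℓ : ℝ) ≤ C * (((A.dim : ℝ) + 1) * max 1 W.stableFaltingsHeight) ^ κ := by
  obtain ⟨κ, C, hκ, h⟩ := stub_genericPartnerBound
  exact ⟨κ, C, hκ, fun W _ _ _ _ E A e he hfree hs hcm ℓ hℓ h5 hsurj hfull hι ↦
    h W E A e he hfree hs hcm ℓ hℓ h5 hsurj hfull hι⟩

/-- **The semistable restriction of the crux from ONE residual** (v12 certificate, by name):
Tate–Ogg + MW + R_gen ⟹ U_ss, through `stub_semistableOfGeneric` fed with the restriction of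
`stub_genericPartnerBound` — no CM residual and no `FaltingsTate`. -/
example (hOgg : ∀ (W : WeierstrassCurve ℚ) [W.IsElliptic], W.conductorNorm ℤ ≠ 1) :
    ∃ κ C : ℝ, 0 ≤ κ ∧ ∀ (W : WeierstrassCurve ℚ) [W.IsElliptic] [W.IsGloballyMinimal]
      [NeZero (W.conductorNorm ℤ)], W.IsSemistable ℤ →
      ∀ (E B : AbelianVariety.{0} ℚ) (e : E.geomPoints ≃+ W.geomPoints),
      (∀ (σ : Field.absoluteGaloisGroup ℚ) (P : E.geomPoints), e (σ • P) = σ • e P) →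
      ∀ ℓ : ℕ, ℓ.Prime →
      (∃ (α : E ⟶ B) (β : B ⟶ E) (n : ℤ), n ≠ 0 ∧ α ≫ β = n • 𝟙 E) →
      (∀ (α : E ⟶ B) (β : B ⟶ E) (n : ℤ), α ≫ β = n • 𝟙 E → (ℓ : ℤ) ∣ n) →
        (ℓ : ℝ) ≤ C * ((B.dim : ℝ) * max 1 W.stableFaltingsHeight) ^ κ :=
  stub_semistableOfGeneric hOgg stub_masserWustholzSurjective genericSemistable_of_stubs

/-! v8: the necessity of the reshaped CM stub is LANDED (…CMUniform.lean, p138450):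
`cmUniformPartnerBound_of_ellipticGluingPrimeBound : EllipticGluingPrimeBound → R_cm^unif`
(unconditional, through `stub_cmHeightBound` proved there), and
`cmUniformPartnerBound_iff_cmCurvePartnerBound : R_cm^unif ↔ R_cm`. -/

example := @cmUniformPartnerBound_of_ellipticGluingPrimeBound
example := @cmUniformPartnerBound_iff_cmCurvePartnerBound
example := @cmUniformSharing_of_cmUniformPartnerBound

/-! `stub_noCMPartnerOfSurjective` (v8 certificate: a surjective-image curve shares no `ℓ`-torsion
with a CM curve beyond an absolute threshold) is LANDED (p139407) and imported (v14, `example` above). -/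

/-! `stub_goursatIndexDichotomy` (O3', the Goursat index dichotomy behind Disproof §3 F9's INDEX
PRINCIPLE) is LANDED (p125204, …StubGoursatIndexDichotomy.lean, wave-1 worker) and imported; it is
the disprover's kernel and does not enter the composition. -/

/-! `stub_iffUniformResiduals` (v9 certificate — {Cor. 4.4, GR pairs, FaltingsTate} ⟹ (U ⟺ R_gen ∧ R_cm^unif),
with the unconditional `uniformResiduals_of_ellipticGluingPrimeBound`) is LANDED (p139643) and imported (v14). -/

/-! ### Composition: LANDED by name (…OfSlices.lean, p126491)

`simpleFreeTorsionBound_of_slices` (MW + R_gen + R_cm ⟹ `U_simple`: CM `W` → R_cm; non-CM `W`,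
`ℓ ≤ c·max(1,h)^γ` or `ℓ < 5` → constant; otherwise `ρ̄_{W,ℓ}` surjective (MW) and the landed
dichotomy `stub_endFieldDichotomy stub_imageDichotomyCore` gives `ℓ ≤ 4 dim² + 1 ≤ 5X²` or a full
congruence over `L_A` → R_gen; `κ = max 2 (max γ (max κ₁ κ₂))`, `C = 5 + max c 0 + max C₁ 0 + max C₂ 0`)
and `ellipticGluingPrimeBound_of_slices_of_masserWustholz` (then `FaltingsTate` + the landed CM
torsion fact give U through `ellipticGluingPrimeBound_of_simple`, p118731/p120127) are tree
theorems now; the skeleton only feeds them the stubs. -/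

/-- `U_simple` from the registered stubs, by the landed composition
`simpleFreeTorsionBound_of_slices` (p126491). -/
theorem simpleFreeTorsionBound_of_stubs :
    ∃ κ C : ℝ, 0 ≤ κ ∧ ∀ (W : WeierstrassCurve ℚ) [W.IsElliptic] (E A : AbelianVariety.{0} ℚ)
      (e : E.geomPoints ≃+ W.geomPoints),
      (∀ (σ : Field.absoluteGaloisGroup ℚ) (P : E.geomPoints), e (σ • P) = σ • e P) →
      (∀ f : E.baseChange (AlgebraicClosure ℚ) ⟶ A.baseChange (AlgebraicClosure ℚ), f = 0) →
      AbelianVariety.IsSimple A →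
      ∀ ℓ : ℕ, ℓ.Prime → W.HasIrreducibleModPGaloisRep ℓ →
      (∃ ι : W.geomTorsion ℓ →+ A.geomPoints, Function.Injective ι ∧
        ∀ (σ : Field.absoluteGaloisGroup ℚ) (P : W.geomTorsion ℓ), ι (σ • P) = σ • ι P) →
        (ℓ : ℝ) ≤ C * (((A.dim : ℝ) + 1) * max 1 W.stableFaltingsHeight) ^ κ :=
  simpleFreeTorsionBound_of_slices stub_masserWustholzSurjective stub_genericPartnerBound
    cmCurvePartnerBound_of_stubs

/-! ### The crux, by name -/

/-- **The crux, concluded by name through the line** (closed modulo the registered stubs):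
`EllipticGluingPrimeBound` from the Masser–Wüstholz fact, the route item `FaltingsTate` and the
two residual slices R_gen, R_cm, by the landed composition
`ellipticGluingPrimeBound_of_slices_of_masserWustholz` (p126491; CM torsion fact and the reduction
`ellipticGluingPrimeBound_of_simple` p118731 inside). -/
theorem ellipticGluingPrimeBound_proof : EllipticGluingPrimeBound :=
  ellipticGluingPrimeBound_of_slices_of_masserWustholz stub_masserWustholzSurjective
    stub_faltingsTate stub_genericPartnerBound cmCurvePartnerBound_of_stubs

/-! ### Certificates (landed): the residuals are crux-necessary (p126295); their `d = 1` shadows are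
`fixedCurveSharing_of_genericPartnerBound` (…ShadowOfGeneric.lean, p126604) and
`cmFixedCurveSharing_of_cmCurvePartnerBound` (…ShadowOfCM.lean, p126661); v8: U ⟹ R_cm^unif
(`cmUniformPartnerBound_of_ellipticGluingPrimeBound`) and the absolute CM shadow
(`cmUniformSharing_of_cmUniformPartnerBound`) are landed in …CMUniform.lean (p138450). -/

example := @genericPartnerBound_of_ellipticGluingPrimeBound
example := @cmCurvePartnerBound_of_ellipticGluingPrimeBound

end Summit.ABC.ABC.Theorems.GluingSlices

end
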